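import Summits.ResolutionOfSingularities.ResolutionOfSingularities.Theorems.FrobeniusLadderFRationalResolutionFixedChartOfSummand
import Mathlib.Algebra.Module.ZMod
import Mathlib.LinearAlgebra.Basis.VectorSpace
import Mathlib.LinearAlgebra.Projection
import HarnessLib

/-!
# Crux `FrobeniusLadder.FRationalResolution` (stmt-ResolutionOfSingularities-15317), line `redirect`,
# stub `stub_diagonalizableQuotientResolution` — item (F2) for ELEMENTARY ABELIAN grading groups: under an `(μ_p)^r`-quotient chart
# (any prime `p`, any characteristic) EVERY point is the image of a FIXED point of a quotient chart of the same shape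

If `p • A = 0` then `A` is a vector space over `𝔽_p` and every subgroup — in particular the unit-degree subgroup `B_𝔔` of a point —
has a complement (Mathlib `Submodule.exists_isCompl`, transported along `AddSubgroup.toZModSubmodule`). So
`…FixedChartOfSummand.exists_fixed_chart_of_isCompl` (p841370) applies at every point:

* ★★★ `exists_fixed_chart_of_elementary` — chart `(A, S, 𝒮, φ)` of hq's shape with `p • A = 0`, point `v`, prime `𝔔` over `v` ⇒ a
  chart of the same shape (regular, finite type, étale, same structure maps) with a FIXED prime over a point mapping to `φ v`.

In characteristic `p` these are exactly the wild `(μ_p)^r`-quotients, for which `…FixedChart` (tame) says nothing. Honest label: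
helper toward ONE leaf stub; no stub, crux or summit closed. No definitions, no named facts, no sorry.
[folklore; cite: SGA3, Exp. VIII §4–5] [cite: StacksProject, Tag 07NG]
-/

noncomputable section

-- single-problem summit: the doubled namespace component is forced
set_option linter.dupNamespace false

open CategoryTheory AlgebraicGeometry
open Literature.AlgebraicGeometry.Resolution

namespace Summit.ResolutionOfSingularities.ResolutionOfSingularities.Theorems.FRationalResolution.FixedChartOfElementary

/-- **Every subgroup of an elementary abelian `p`-group has a complement.** [folklore] -/
theorem exists_compl_of_elementary {A : Type} [AddCommGroup A] (p : ℕ) [Fact p.Prime] (hpA : ∀ x : A, p • x = 0)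
    (B : AddSubgroup A) : ∃ C : AddSubgroup A, B ⊔ C = ⊤ ∧ B ⊓ C = ⊥ := by
  letI inst : Module (ZMod p) A := AddCommGroup.zmodModule hpA
  obtain ⟨Q, hQ⟩ := @Submodule.exists_isCompl (ZMod p) A _ _ inst (AddSubgroup.toZModSubmodule p B)
  refine ⟨Q.toAddSubgroup, ?_, ?_⟩
  · rw [eq_top_iff]
    intro x _
    obtain ⟨y, z, hyz, -⟩ := Submodule.existsUnique_add_of_isCompl hQ x
    exact AddSubgroup.mem_sup.2 ⟨y, y.2, z, z.2, hyz⟩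
  · rw [eq_bot_iff]
    rintro x ⟨hxB, hxQ⟩
    obtain ⟨y, z, -, huniq⟩ := Submodule.existsUnique_add_of_isCompl hQ x
    have h1 := (huniq ⟨x, hxB⟩ ⟨0, Q.zero_mem⟩ (add_zero x)).1
    have h2 := (huniq ⟨0, (AddSubgroup.toZModSubmodule p B).zero_mem⟩ ⟨x, hxQ⟩ (zero_add x)).1
    exact AddSubgroup.mem_bot.2 (congrArg Subtype.val (h1.trans h2.symm))

/-- ★★★ **Item (F2) for elementary abelian grading groups.** Let `φ : Spec S₀ → X` be a chart of the stub's shape (`S` regular of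
finite type over the field `k`, graded by the finite abelian group `A`, `φ` étale with `φ ≫ g = Spec (k → S₀)`) with `p • A = 0` for a
prime `p`. Then for every point `v` of `Spec S₀` and prime `𝔔` of `S` over `v` there are a chart `φ' : Spec S'₀ → X` of the same shape
and a FIXED prime `𝔔'` of `S'` over a point `v'` with `φ' v' = φ v`. No tameness hypothesis.
[folklore; cite: SGA3, Exp. VIII §4–5] [cite: StacksProject, Tag 07NG] -/
theorem exists_fixed_chart_of_elementary (k : Type) [Field k] (X : Scheme.{0}) (g : X ⟶ Spec (.of k))
    (A : Type) [AddCommGroup A] [Finite A] [DecidableEq A] (p : ℕ) [Fact p.Prime] (hpA : ∀ x : A, p • x = 0)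
    (S : Type) [CommRing S] [Algebra k S]
    (𝒮 : A → Submodule k S) [GradedAlgebra 𝒮] [Algebra.FiniteType k S] [IsRegularRing S]
    (φ : Spec (.of (𝒮 0)) ⟶ X) [Etale φ]
    (hφg : φ ≫ g = Spec.map (CommRingCat.ofHom (algebraMap k (𝒮 0))))
    (v : Spec (.of (𝒮 0))) (𝔔 : Ideal S) [𝔔.IsPrime] (h𝔔v : 𝔔.comap (algebraMap (𝒮 0) S) = v.asIdeal) :
    ∃ (A' : Type) (_ : AddCommGroup A') (_ : Finite A') (_ : DecidableEq A')
      (S' : Type) (_ : CommRing S') (_ : Algebra k S') (𝒮' : A' → Submodule k S')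
      (_ : GradedAlgebra 𝒮'),
      Algebra.FiniteType k S' ∧ IsRegularRing S' ∧
      ∃ (φ' : Spec (.of (𝒮' 0)) ⟶ X), Etale φ' ∧
        φ' ≫ g = Spec.map (CommRingCat.ofHom (algebraMap k (𝒮' 0))) ∧
        ∃ (v' : Spec (.of (𝒮' 0))) (𝔔' : Ideal S') (_ : 𝔔'.IsPrime),
          𝔔'.comap (algebraMap (𝒮' 0) S') = v'.asIdeal ∧
          (∀ c : A', c ≠ 0 → ∀ s ∈ 𝒮' c, s ∈ 𝔔') ∧ φ' v' = φ v := by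
  have hA : AddMonoid.IsTorsion A := fun i => isOfFinAddOrder_of_finite i
  obtain ⟨B, hB, -⟩ := StabilizerSubgroup.exists_unitDegrees_addSubgroup 𝒮 hA 𝔔
  obtain ⟨C, hsup, hinf⟩ := exists_compl_of_elementary p hpA B
  exact FixedChartOfSummand.exists_fixed_chart_of_isCompl k X g A S 𝒮 φ hφg v 𝔔 h𝔔v B C hB hsup hinf

end Summit.ResolutionOfSingularities.ResolutionOfSingularities.Theorems.FRationalResolution.FixedChartOfElementary

end
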